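import Literature.Analysis.OperatorTheory.KnabeGapAmplificationCount
import Mathlib.Analysis.SpecificLimits.Basic

/-!
# Knabe's local-gap amplification on `(ℤ/M)⁴` — the squaring argument (`KnabeWith 2 (6000/(2n-1)) 1`)

The amplification theorem for the vocabulary of `Literature/Analysis/OperatorTheory/KnabeGapAmplification.lean`:
`knabeWith_two : KnabeWith 2 (fun n => 6000 / (2 * n - 1)) 1` — for orthogonal projections `Q x` on a real Hilbert
space indexed by the torus `(ℤ/M)⁴`, commuting unless all four cyclic index distances are `≤ 2`, the local inequalities
`γ A_x ≤ A_x²` for the `n`-patch operators imply `(γ - 6000/(2n-1)) H ≤ H²` (`n ≥ 1`, `4(n+2) ≤ M`), (Knabe 1988 §2; Gosset–Mozgunov 2016 Thm. 1); the packaged `∃ t → 0, c > 0` form is the Summits-side stub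
`…LatticeGapInUVUnits.KnabeBlockSampler.stub_knabeAmplification` and is not repeated here.
Proof (Knabe's squaring argument), on the diagonal of the quadratic forms at a vector `v` with
`q(y,z) = ⟪Q_y v, Q_z v⟫`: `∑ₓ ‖A_x v‖² = ∑_{y,z} N(y,z) q(y,z)` with `N(y,z) = #{x | y, z ∈ patch x}`; far pairs have
`q ≥ 0` (commuting projections) and `N ≤ N_p = (2n-1)⁴`; near pairs use `-2q(y,z) ≤ q(y,y) + q(z,z)` and the count
`∑_{z near y} (N_p - N(y,z)) ≤ N_p · 6000/(2n-1)` of `KnabeGapAmplificationCount.lean`.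
Not here: general lattices / ranges (Knabe's and Gosset–Mozgunov's sharper thresholds), see the vocabulary file.

References: S. Knabe, J. Stat. Phys. 52 (1988) 627–638, §2; D. Gosset, E. Mozgunov, J. Math. Phys. 57 (2016) 091901.
-/

open scoped BigOperators InnerProductSpace
open Filter Topology

noncomputable section

namespace Literature.Analysis.OperatorTheory.KnabeDevice

/-- The scalar core of Knabe's squaring argument: from the summed local inequality
`γ N_p S ≤ ∑ N(y,z) q(y,z)` to `(γ - τ) S ≤ ∑ q(y,z)`, splitting pairs into far ones (`q ≥ 0`, `N ≤ N_p`) and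
near ones (`-2q(y,z) ≤ q(y,y) + q(z,z)` and the defect bound `∑_{z near y} (N_p - N(y,z)) ≤ N_p τ`).
[cite: Knabe1988, §2] -/
theorem sub_mul_sum_le_of_pairCount {ι : Type*} [Fintype ι] (near : ι → ι → Prop) [DecidableRel near]
    (q N : ι → ι → ℝ) (Np τ γ : ℝ) (hNp : 0 < Np) (near_symm : ∀ y z, near y z → near z y)
    (q_diag : ∀ y, 0 ≤ q y y) (q_bound : ∀ y z, -(2 * q y z) ≤ q y y + q z z)
    (q_far : ∀ y z, ¬ near y z → 0 ≤ q y z) (N_symm : ∀ y z, N y z = N z y) (N_le : ∀ y z, N y z ≤ Np)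
    (N_near : ∀ y, ∑ z ∈ Finset.univ.filter (near y), (Np - N y z) ≤ Np * τ)
    (hyp : γ * (Np * ∑ y, q y y) ≤ ∑ y, ∑ z, N y z * q y z) :
    (γ - τ) * ∑ y, q y y ≤ ∑ y, ∑ z, q y z := by
  have hDs : ∀ y z, (if near y z then Np - N y z else 0) = if near z y then Np - N z y else 0 := fun y z => by
    rw [N_symm y z]
    by_cases h : near y z
    · rw [if_pos h, if_pos (near_symm _ _ h)]
    · rw [if_neg h, if_neg fun h' => h (near_symm _ _ h')]
  have hD : ∀ y z, N y z * q y z ≤ Np * q y z + ((if near y z then Np - N y z else 0) * q y y / 2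
      + (if near z y then Np - N z y else 0) * q z z / 2) := fun y z => by
    rw [← hDs y z]
    have h1 : 0 ≤ Np - N y z := sub_nonneg.mpr (N_le y z)
    split_ifs with h
    · nlinarith [q_bound y z]
    · nlinarith [q_far y z h]
  have hrow : ∀ y, ∑ z, (if near y z then Np - N y z else 0) * q y y / 2 ≤ Np * τ * q y y / 2 := fun y => by
    rw [← Finset.sum_div, ← Finset.sum_mul]
    refine div_le_div_of_nonneg_right (mul_le_mul_of_nonneg_right ?_ (q_diag y)) two_pos.le
    rw [← Finset.sum_filter]
    exact N_near y
  have hmain : ∑ y, ∑ z, N y z * q y z ≤ Np * ∑ y, ∑ z, q y z + Np * τ * ∑ y, q y y :=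
    calc ∑ y, ∑ z, N y z * q y z
        ≤ ∑ y, ∑ z, (Np * q y z + ((if near y z then Np - N y z else 0) * q y y / 2
            + (if near z y then Np - N z y else 0) * q z z / 2)) :=
          Finset.sum_le_sum fun y _ => Finset.sum_le_sum fun z _ => hD y z
      _ = Np * ∑ y, ∑ z, q y z + ((∑ y, ∑ z, (if near y z then Np - N y z else 0) * q y y / 2)
            + ∑ y, ∑ z, (if near z y then Np - N z y else 0) * q z z / 2) := by
          simp only [Finset.sum_add_distrib, Finset.mul_sum]
      _ = Np * ∑ y, ∑ z, q y z + 2 * ∑ y, ∑ z, (if near y z then Np - N y z else 0) * q y y / 2 := by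
          rw [two_mul]
          congr 2
          exact Finset.sum_comm
      _ ≤ Np * ∑ y, ∑ z, q y z + 2 * ∑ y, Np * τ * q y y / 2 :=
          add_le_add (le_refl _) (mul_le_mul_of_nonneg_left (Finset.sum_le_sum fun y _ => hrow y) two_pos.le)
      _ = Np * ∑ y, ∑ z, q y z + Np * τ * ∑ y, q y y := by
          congr 1
          rw [Finset.mul_sum, Finset.mul_sum]
          exact Finset.sum_congr rfl fun y _ => by ring
  have h2 : Np * ((γ - τ) * ∑ y, q y y) ≤ Np * ∑ y, ∑ z, q y z := by nlinarith [hmain, hyp]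
  exact le_of_mul_le_mul_left h2 hNp

/-- For an orthogonal projection on a real Hilbert space, `⟪P v, v⟫ = ⟪P v, P v⟫`. [folklore] -/
theorem inner_proj_apply_self {E : Type} [NormedAddCommGroup E] [InnerProductSpace ℝ E] [CompleteSpace E]
    {P : E →L[ℝ] E} (hP : IsSelfAdjoint P ∧ P * P = P) (v : E) : ⟪P v, v⟫_ℝ = ⟪P v, P v⟫_ℝ := by
  have hs : ∀ a b, ⟪P a, b⟫_ℝ = ⟪a, P b⟫_ℝ := fun a b => hP.1.isSymmetric a b
  conv_lhs => rw [← hP.2, mul_apply_eq_comp]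
  exact hs _ _

/-- Commuting orthogonal projections have a nonnegative mixed form: `⟪P v, R v⟫ = ‖P R v‖² ≥ 0`. [folklore] -/
theorem inner_proj_proj_nonneg_of_commute {E : Type} [NormedAddCommGroup E] [InnerProductSpace ℝ E]
    [CompleteSpace E] {P R : E →L[ℝ] E} (hP : IsSelfAdjoint P ∧ P * P = P) (hR : IsSelfAdjoint R ∧ R * R = R)
    (h : P * R = R * P) (v : E) : 0 ≤ ⟪P v, R v⟫_ℝ := by
  have hPs : ∀ a b, ⟪P a, b⟫_ℝ = ⟪a, P b⟫_ℝ := fun a b => hP.1.isSymmetric a b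
  have hRs : ∀ a b, ⟪R a, b⟫_ℝ = ⟪a, R b⟫_ℝ := fun a b => hR.1.isSymmetric a b
  have hu : R (R v) = R v := by rw [← mul_apply_eq_comp, hR.2]
  have key : ⟪P v, R v⟫_ℝ = ⟪P (R v), P (R v)⟫_ℝ :=
    calc ⟪P v, R v⟫_ℝ = ⟪v, P (R (R v))⟫_ℝ := by rw [hu]; exact hPs v (R v)
      _ = ⟪v, R (P (R v))⟫_ℝ := by rw [← mul_apply_eq_comp P R, h, mul_apply_eq_comp]
      _ = ⟪R v, P (P (R v))⟫_ℝ := by rw [← mul_apply_eq_comp P P, hP.2]; exact (hRs v (P (R v))).symm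
      _ = ⟪P (R v), P (R v)⟫_ℝ := (hPs (R v) (P (R v))).symm
  rw [key]
  exact real_inner_self_nonneg

/-- The Loewner order evaluated on the diagonal: `A ≤ B → ⟪A v, v⟫ ≤ ⟪B v, v⟫`. [folklore] -/
theorem inner_apply_self_le_of_le {E : Type} [NormedAddCommGroup E] [InnerProductSpace ℝ E]
    {A B : E →L[ℝ] E} (h : A ≤ B) (v : E) : ⟪A v, v⟫_ℝ ≤ ⟪B v, v⟫_ℝ := by
  rw [ContinuousLinearMap.le_def] at h
  have h2 := h.inner_nonneg_left v
  rw [sub_apply, inner_sub_left] at h2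
  linarith

/-- The Loewner order from the diagonal, for symmetric operators on a real space:
if `⟪A v, v⟫ ≤ ⟪B v, v⟫` for all `v` then `A ≤ B`. [folklore] -/
theorem le_of_inner_apply_self_le {E : Type} [NormedAddCommGroup E] [InnerProductSpace ℝ E]
    {A B : E →L[ℝ] E} (hA : ∀ a b, ⟪A a, b⟫_ℝ = ⟪a, A b⟫_ℝ) (hB : ∀ a b, ⟪B a, b⟫_ℝ = ⟪a, B b⟫_ℝ)
    (h : ∀ v, ⟪A v, v⟫_ℝ ≤ ⟪B v, v⟫_ℝ) : A ≤ B := by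
  rw [ContinuousLinearMap.le_def, ContinuousLinearMap.isPositive_iff]
  refine ⟨fun a b => ?_, fun v => ?_⟩
  · show ⟪(B - A) a, b⟫_ℝ = ⟪a, (B - A) b⟫_ℝ
    simp only [sub_apply, inner_sub_left, inner_sub_right, hA a b, hB a b]
  · show 0 ≤ ⟪(B - A) v, v⟫_ℝ
    rw [sub_apply, inner_sub_left]
    exact sub_nonneg.mpr (h v)

/-- **Knabe's local-gap amplification on `(ℤ/M)⁴`, non-commuting radius `2`** (Knabe 1988 §2; Gosset–Mozgunov 2016
Thm. 1, torus form): `KnabeWith 2 (fun n => 6000 / (2n - 1)) 1` — for orthogonal projections `Q x` on a real Hilbert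
space indexed by `(ℤ/M)⁴`, commuting unless all four cyclic index distances are `≤ 2`, if every `n`-patch operator
satisfies `γ A_x ≤ A_x²` (`n ≥ 1`, `4(n+2) ≤ M`, `γ ≥ 0`) then `(γ - 6000/(2n-1)) H ≤ H²` for `H = ∑ₓ Q x`.
Squaring argument with the pair counting of `KnabeGapAmplificationCount.lean`. [cite: Knabe1988, §2] -/
theorem knabeWith_two : KnabeWith 2 (fun n => 6000 / (2 * n - 1)) 1 := by
  intro M E _ _ _ Q hQ hcomm n γ hn hM _ hloc
  haveI : NeZero M := ⟨by omega⟩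
  -- symmetry of the `Q x`, of `H = totalOp Q` and of the `A_x = patchOp Q n x`; the patch indicator `ind`
  have hQs : ∀ x a b, ⟪Q x a, b⟫_ℝ = ⟪a, Q x b⟫_ℝ := fun x a b => (hQ x).1.isSymmetric a b
  have hH_apply : ∀ v, totalOp Q v = ∑ x, Q x v := fun v => by simp only [totalOp, sum_apply]
  have hHs : ∀ a b, ⟪totalOp Q a, b⟫_ℝ = ⟪a, totalOp Q b⟫_ℝ := fun a b => by
    simp only [hH_apply, sum_inner, inner_sum]
    exact Finset.sum_congr rfl fun x _ => hQs x a b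
  obtain ⟨ind, hind⟩ : ∃ ind : (Fin 4 → Fin M) → (Fin 4 → Fin M) → ℝ,
      ∀ x y, ind x y = if (∀ k, cdist (y k) (x k) < n) then 1 else 0 := ⟨_, fun _ _ => rfl⟩
  have hind01 : ∀ x y, 0 ≤ ind x y ∧ ind x y ≤ 1 := fun x y => by rw [hind]; split_ifs <;> norm_num
  have hA_apply : ∀ x v, patchOp Q n x v = ∑ y, ind x y • Q y v := fun x v => by
    simp only [patchOp, sum_apply]
    refine Finset.sum_congr rfl fun y _ => ?_
    rw [hind]
    split_ifs <;> simp
  have hAs : ∀ x a b, ⟪patchOp Q n x a, b⟫_ℝ = ⟪a, patchOp Q n x b⟫_ℝ := fun x a b => by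
    simp only [hA_apply, sum_inner, inner_sum, real_inner_smul_left, real_inner_smul_right]
    exact Finset.sum_congr rfl fun y _ => by rw [hQs y a b]
  have hL0 : (0 : ℝ) < ((2 * n - 1 : ℕ) : ℝ) := by exact_mod_cast (by omega : 0 < 2 * n - 1)
  have hdiag : ∀ y, ∑ x, ind x y = ((2 * n - 1 : ℕ) : ℝ) ^ 4 := fun y => by
    simp only [hind]
    exact sum_patchIndicator_eq n (by omega) y
  -- reduce to the diagonal of the quadratic forms at a vector `v`; `q y z = ⟪Q y v, Q z v⟫`
  refine le_of_inner_apply_self_le (fun a b => ?_) (fun a b => ?_) (fun v => ?_)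
  · simp only [smul_apply, real_inner_smul_left, real_inner_smul_right, hHs a b]
  · simp only [mul_apply_eq_comp]
    rw [hHs (totalOp Q a) b, hHs a (totalOp Q b)]
  obtain ⟨q, hq⟩ : ∃ q : (Fin 4 → Fin M) → (Fin 4 → Fin M) → ℝ, ∀ y z, q y z = ⟪Q y v, Q z v⟫_ℝ :=
    ⟨_, fun _ _ => rfl⟩
  have hS : ⟪totalOp Q v, v⟫_ℝ = ∑ y, q y y := by
    rw [hH_apply, sum_inner]
    exact Finset.sum_congr rfl fun y _ => by rw [hq, inner_proj_apply_self (hQ y)]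
  have hT : ⟪totalOp Q v, totalOp Q v⟫_ℝ = ∑ y, ∑ z, q y z := by
    rw [hH_apply, sum_inner]
    refine Finset.sum_congr rfl fun y _ => ?_
    rw [inner_sum]
    exact Finset.sum_congr rfl fun z _ => (hq y z).symm
  -- the local hypothesis on the diagonal, summed over `x`
  have hlocv : ∀ x, γ * ∑ y, ind x y * q y y ≤ ∑ y, ∑ z, ind x y * ind x z * q y z := fun x => by
    have h1 := inner_apply_self_le_of_le (hloc x) v
    rw [smul_apply, real_inner_smul_left, mul_apply_eq_comp, hAs x (patchOp Q n x v) v] at h1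
    have e1 : ⟪patchOp Q n x v, v⟫_ℝ = ∑ y, ind x y * q y y := by
      rw [hA_apply, sum_inner]
      exact Finset.sum_congr rfl fun y _ => by rw [real_inner_smul_left, hq, inner_proj_apply_self (hQ y)]
    have e2 : ⟪patchOp Q n x v, patchOp Q n x v⟫_ℝ = ∑ y, ∑ z, ind x y * ind x z * q y z := by
      rw [hA_apply, sum_inner]
      refine Finset.sum_congr rfl fun y _ => ?_
      rw [inner_sum]
      exact Finset.sum_congr rfl fun z _ => by rw [real_inner_smul_left, real_inner_smul_right, hq]; ring
    rwa [e1, e2] at h1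
  have hyp : γ * (((2 * n - 1 : ℕ) : ℝ) ^ 4 * ∑ y, q y y) ≤ ∑ y, ∑ z, (∑ x, ind x y * ind x z) * q y z := by
    have h1 : ∑ x, γ * ∑ y, ind x y * q y y ≤ ∑ x, ∑ y, ∑ z, ind x y * ind x z * q y z :=
      Finset.sum_le_sum fun x _ => hlocv x
    have e1 : ∑ x, γ * ∑ y, ind x y * q y y = γ * (((2 * n - 1 : ℕ) : ℝ) ^ 4 * ∑ y, q y y) := by
      rw [← Finset.mul_sum, Finset.sum_comm]
      congr 1
      rw [Finset.mul_sum]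
      exact Finset.sum_congr rfl fun y _ => by rw [← Finset.sum_mul, hdiag y]
    have e2 : ∑ x, ∑ y, ∑ z, ind x y * ind x z * q y z = ∑ y, ∑ z, (∑ x, ind x y * ind x z) * q y z := by
      rw [Finset.sum_comm]
      refine Finset.sum_congr rfl fun y _ => ?_
      rw [Finset.sum_comm]
      exact Finset.sum_congr rfl fun z _ => by rw [Finset.sum_mul]
    rwa [e1, e2] at h1
  -- hypotheses of the scalar core
  have near_symm : ∀ y z : Fin 4 → Fin M, (∀ k, cdist (y k) (z k) ≤ 2) → ∀ k, cdist (z k) (y k) ≤ 2 :=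
    fun y z h k => by rw [cdist_comm]; exact h k
  have q_diag : ∀ y, 0 ≤ q y y := fun y => by rw [hq]; exact real_inner_self_nonneg
  have q_bound : ∀ y z, -(2 * q y z) ≤ q y y + q z z := fun y z => by
    have h0 := real_inner_self_nonneg (x := Q y v + Q z v)
    rw [real_inner_add_add_self] at h0
    rw [hq, hq, hq]
    linarith
  have q_far : ∀ y z : Fin 4 → Fin M, ¬ (∀ k, cdist (y k) (z k) ≤ 2) → 0 ≤ q y z := fun y z h => by
    push Not at h
    rw [hq]
    exact inner_proj_proj_nonneg_of_commute (hQ y) (hQ z) (hcomm y z (h.imp fun k hk => hk)) v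
  have N_symm : ∀ y z, ∑ x, ind x y * ind x z = ∑ x, ind x z * ind x y :=
    fun y z => Finset.sum_congr rfl fun x _ => mul_comm _ _
  have N_le : ∀ y z, ∑ x, ind x y * ind x z ≤ ((2 * n - 1 : ℕ) : ℝ) ^ 4 := fun y z => by
    rw [← hdiag y]
    exact Finset.sum_le_sum fun x _ => mul_le_of_le_one_right (hind01 x y).1 (hind01 x z).2
  have N_near : ∀ y, ∑ z ∈ Finset.univ.filter (fun z : Fin 4 → Fin M => ∀ k, cdist (y k) (z k) ≤ 2),
      (((2 * n - 1 : ℕ) : ℝ) ^ 4 - ∑ x, ind x y * ind x z)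
        ≤ ((2 * n - 1 : ℕ) : ℝ) ^ 4 * (6000 / (2 * n - 1)) := by
    intro y
    simp only [hind]
    exact sum_near_patchDefect_le n hn hM y
  have key : (γ - 6000 / (2 * n - 1)) * ∑ y, q y y ≤ ∑ y, ∑ z, q y z :=
    sub_mul_sum_le_of_pairCount (fun y z : Fin 4 → Fin M => ∀ k, cdist (y k) (z k) ≤ 2) q
      (fun y z => ∑ x, ind x y * ind x z) _ _ γ (pow_pos hL0 4)
      near_symm q_diag q_bound q_far N_symm N_le N_near hyp
  rw [smul_apply, real_inner_smul_left, mul_apply_eq_comp, hHs (totalOp Q v) v, hS, hT, one_mul]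
  exact key

end Literature.Analysis.OperatorTheory.KnabeDevice

end
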